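import Literature.NumberTheory.IwasawaTheory.ClassicalMuVanishesCyclicAscentOddRelative
import Literature.NumberTheory.IwasawaTheory.ClassicalMuVanishesKleinDescent
import Literature.NumberTheory.IwasawaTheory.ClassicalMuVanishesFiniteDescent
import Mathlib.GroupTheory.IndexNormal
import Mathlib.GroupTheory.Sylow
import HarnessLib

/-!
# `μ_p = 0` ascends EVERY finite Galois `p`-extension inside the cyclotomic `ℤ_p`-tower over `ℚ` (`p` odd):
# `μ_p(K·ℚ_∞/K) = 0 ⟹ μ_p(K'·ℚ_∞/K') = 0` for `K'/K` Galois of degree `p^m` (Iwasawa 1973 iterated along a normal series; proved)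

`Proofs`-style file (theorems only, no definition, no named fact, no `sorry`) in topic `NumberTheory/IwasawaTheory` (namespace
`Literature.NumberTheory.IwasawaTheory`), written by the prover seat `bsd-potss-rkm` g42 (cell `bsd-potss`; library pass, sequel of
`ClassicalMuVanishesCyclicAscentOdd{,Rat,Relative}.lean`).

A finite `p`-group `G = Gal(K'/K)` of order `p^{m+1}` has a subgroup `H` of order `p^m` (Sylow), of index `p` = the least prime factor of
`#G`, hence NORMAL; `M = K'^H` is Galois of degree `p` over `K` and `K'/M` is Galois of degree `p^m`.  So the one-step ascent
`classicalMuVanishes_restrict_of_restrict_of_isGalois_of_finrank_eq_odd` (degree `p`, ramification bound discharged) iterates by induction on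
`m`: for `p` odd, `κ` a cyclotomic `ℤ_p`-extension of `ℚ`, `K ⊆ K'` number fields with `κ ∘ res` onto for both, `K'/K` GALOIS OF `p`-POWER
DEGREE: **`ClassicalMuVanishes (κ|_K) ⟹ ClassicalMuVanishes (κ|_{K'})`**.  With `K = ℚ` (`classicalMuVanishes_rat`, Iwasawa 1956): `μ_p = 0`
for every finite Galois `p`-extension of `ℚ` linearly disjoint from `ℚ_∞` — a class of number fields, non-abelian in general, on which
Iwasawa's `μ`-conjecture is a theorem of the tree with no `L`-function input.

* `classicalMuVanishes_restrict_of_restrict_of_isGalois_of_finrank_eq_prime_pow_odd` (any base `K` in the tower);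
* `classicalMuVanishes_restrict_rat_of_isGalois_of_finrank_eq_prime_pow_odd` (base `ℚ`, unconditional).

HONEST SCOPE.  Elementary given the previous files; the linear-disjointness proviso `κ ∘ res_{K'/ℚ}` onto (`K' ∩ ℚ_∞ = ℚ`) is needed to form
the restricted tower in the tree's currency and is NOT automatic for `p`-extensions (`ℚ_1 ⊆ ℚ_∞` has degree `p`).  Nothing about elliptic
curves or BSD is asserted; no K9/KT row of cell `bsd-potss` consumes this file.

References: [Iwasawa1973MuInvariants] Thm. 2–3 (ℓ odd; `p`-extensions by iteration); [Washington1997] §13.3 Prop. 13.23; [Lang1990] Ch. 13 §4.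
-/

set_option autoImplicit false

noncomputable section

open scoped NumberField Classical
open NumberField Field IntermediateField IsDedekindDomain Module

namespace Literature.NumberTheory.IwasawaTheory

open Literature.NumberTheory.EllipticCurves Literature.NumberTheory.EllipticCurves.ZpExtension
  Literature.NumberTheory.GaloisRepresentations Literature.NumberTheory.NumberFields

variable {p : ℕ} [hp : Fact p.Prime]

/-- **`μ_p = 0` ascends every finite Galois `p`-extension inside the cyclotomic tower.**  `p` odd, `κ` a cyclotomic `ℤ_p`-extension of `ℚ`;
for every `m` and all number fields `K ⊆ K'` with `K'/K` Galois of degree `p^m` and `κ ∘ res` onto for `K` and `K'`: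
`ClassicalMuVanishes (κ|_K) ⟹ ClassicalMuVanishes (κ|_{K'})`.  Induction on `m` along a normal subgroup of index `p` of the `p`-group
`Gal(K'/K)` (Sylow + «index = least prime factor ⟹ normal»), the degree-`p` step being
`classicalMuVanishes_restrict_of_restrict_of_isGalois_of_finrank_eq_odd`. [cite: Iwasawa1973MuInvariants, Thm. 2–3 (ℓ odd)]
[cite: Washington1997, §13.3 Prop. 13.23] -/
theorem classicalMuVanishes_restrict_of_restrict_of_isGalois_of_finrank_eq_prime_pow_odd (hodd : p ≠ 2) {κ : ZpExtension ℚ p}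
    (hκ : κ.IsCyclotomic) :
    ∀ (m : ℕ) (K K' : Type) [Field K] [NumberField K] [Field K'] [NumberField K'] [Algebra K K']
      [IsScalarTower ℚ K K'] [IsGalois K K'], Module.finrank K K' = p ^ m →
      ∀ (hK : Function.Surjective (κ.toContinuousMonoidHom.comp (absGaloisRestrict ℚ K)))
        (hK' : Function.Surjective (κ.toContinuousMonoidHom.comp (absGaloisRestrict ℚ K'))),
        ClassicalMuVanishes (κ.restrict K hK) → ClassicalMuVanishes (κ.restrict K' hK') := by
  have hpp : p.Prime := hp.out
  intro m
  induction m with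
  | zero =>
    intro K K' _ _ _ _ _ _ _ hdeg hK hK' hμ
    -- `[K' : K] = 1`: `K ≃ K'` over `ℚ`, transport
    haveI : FiniteDimensional K K' := Module.Finite.of_restrictScalars_finite ℚ K K'
    have hsurj : Function.Surjective (algebraMap K K') := fun x => by
      have hx : x ∈ (⊥ : Subalgebra K K') := by
        rw [Subalgebra.bot_eq_top_of_finrank_eq_one (by rw [hdeg, pow_zero])]; exact Algebra.mem_top
      exact Algebra.mem_bot.mp hx
    let φ : K ≃ₐ[ℚ] K' :=
      AlgEquiv.ofBijective (IsScalarTower.toAlgHom ℚ K K') ⟨(algebraMap K K').injective, hsurj⟩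
    exact (classicalMuVanishes_restrict_iff_of_algEquiv κ φ hK hK').mp hμ
  | succ m ih =>
    intro K K' _ _ _ _ _ _ _ hdeg hK hK' hμ
    haveI : FiniteDimensional K K' := Module.Finite.of_restrictScalars_finite ℚ K K'
    -- a normal subgroup of index `p`
    have hcardG : Nat.card (K' ≃ₐ[K] K') = p ^ (m + 1) := by rw [IsGalois.card_aut_eq_finrank, hdeg]
    obtain ⟨H, hH⟩ := Sylow.exists_subgroup_card_pow_prime p (n := m) (G := K' ≃ₐ[K] K')
      (by rw [hcardG]; exact pow_dvd_pow p (Nat.le_succ m))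
    have hindex : H.index = p := by
      have h1 := H.index_mul_card
      rw [hH, hcardG, pow_succ, mul_comm (p ^ m) p] at h1
      exact Nat.eq_of_mul_eq_mul_right (pow_pos hpp.pos m) h1
    haveI : H.Normal := Subgroup.normal_of_index_eq_minFac_card (by
      rw [hindex, hcardG, Nat.pow_minFac (Nat.succ_ne_zero m), hpp.minFac_eq])
    -- the intermediate field `M = K'^H`
    set M : IntermediateField K K' := IntermediateField.fixedField H with hM
    haveI : NumberField ↥M := NumberField.of_module_finite K ↥M
    haveI : IsScalarTower ℚ K ↥M := IsScalarTower.of_algebraMap_eq' (Subsingleton.elim _ _)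
    haveI : IsScalarTower ℚ ↥M K' := IsScalarTower.of_algebraMap_eq' (Subsingleton.elim _ _)
    haveI : IsGalois ↥M K' := IsGalois.tower_top_of_isGalois K ↥M K'
    have hMK' : Module.finrank ↥M K' = p ^ m := by rw [hM, IntermediateField.finrank_fixedField_eq_card, hH]
    have hKM : Module.finrank K ↥M = p := by
      have h1 := Module.finrank_mul_finrank K ↥M K'
      rw [hMK', hdeg, pow_succ, mul_comm (p ^ m) p] at h1
      exact Nat.eq_of_mul_eq_mul_right (pow_pos hpp.pos m) h1
    have hMs : Function.Surjective (κ.toContinuousMonoidHom.comp (absGaloisRestrict ℚ ↥M)) :=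
      surjective_comp_absGaloisRestrict_of_tower κ ↥M K' hK'
    -- the degree-`p` step `K ⊆ M`, then the induction hypothesis for `M ⊆ K'`
    have hμM : ClassicalMuVanishes (κ.restrict ↥M hMs) :=
      classicalMuVanishes_restrict_of_restrict_of_isGalois_of_finrank_eq_odd hodd hκ K ↥M hKM hK hMs hμ
    exact ih ↥M K' hMK' hMs hK' hμM

/-- **`μ_p = 0` for every finite Galois `p`-extension of `ℚ` linearly disjoint from `ℚ_∞` (`p` odd), unconditionally.**  `κ` a cyclotomic
`ℤ_p`-extension of `ℚ`, `K'/ℚ` Galois of degree `p^m` with `κ ∘ res_{K'/ℚ}` onto: `ClassicalMuVanishes (κ|_{K'})` — base `μ_p(ℚ_∞/ℚ) = 0`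
(`classicalMuVanishes_rat`, Iwasawa 1956; transported to `κ|_ℚ` along the identity) and the `p`-power ascent.
[cite: Iwasawa1973MuInvariants, Thm. 2–3 (ℓ odd)] [cite: Washington1997, §13.3 Prop. 13.23] -/
theorem classicalMuVanishes_restrict_rat_of_isGalois_of_finrank_eq_prime_pow_odd (hodd : p ≠ 2) {κ : ZpExtension ℚ p}
    (hκ : κ.IsCyclotomic) (m : ℕ) (K' : Type) [Field K'] [NumberField K'] [IsGalois ℚ K']
    (hdeg : Module.finrank ℚ K' = p ^ m)
    (hK' : Function.Surjective (κ.toContinuousMonoidHom.comp (absGaloisRestrict ℚ K'))) :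
    ClassicalMuVanishes (κ.restrict K' hK') := by
  have hQ : Function.Surjective (κ.toContinuousMonoidHom.comp (absGaloisRestrict ℚ ℚ)) :=
    surjective_comp_absGaloisRestrict_of_tower κ ℚ K' hK'
  haveI : IsScalarTower ℚ ℚ K' := IsScalarTower.of_algebraMap_eq' (Subsingleton.elim _ _)
  refine classicalMuVanishes_restrict_of_restrict_of_isGalois_of_finrank_eq_prime_pow_odd hodd hκ m ℚ K' hdeg hQ hK' ?_
  -- `κ|_ℚ` is a `ℤ_p`-extension of `ℚ`: `μ = 0` by Iwasawa 1956
  exact classicalMuVanishes_rat (κ.restrict ℚ hQ)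

end Literature.NumberTheory.IwasawaTheory

end
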